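import Mathlib
import Summits.QuantumAdvantage.QuantumAdvantage.Theses.MobiusLadder
import Summits.QuantumAdvantage.QuantumAdvantage.Theorems.MobiusLadderDigitPolyUniformityKnownClasses
import Summits.QuantumAdvantage.QuantumAdvantage.Theorems.MobiusLadderQuadraticDigitPhasesStubOneCutKataiCS

/-!
# Crux `DigitPolyUniformity` (stmt-QuantumAdvantage-1392): `λ` is orthogonal to every `𝔽₂`-phase that is
# a sum of `≤ n^c` PRODUCTS OF AFFINE FORMS — unconditionally (any degree, any number of digits)

A third unconditional sub-class of the crux, beyond total degree `≤ 1` and `(log₂ n)^A`-juntas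
(`Theorems/…KnownClasses`): the phases of

  `P = A + Σ_{j<h} Π_{i<D} L_{j,i}`,  `A` and every `L_{j,i}` affine (total degree `≤ 1`), `h ≤ n^c`,

with NO restriction on `D`, on the degree, or on how many digit positions occur. This class contains
* every quadratic polynomial of symplectic rank `≤ 2h` (Dickson normal form: affine `+ Σ_{j<h} L_j M_j`),
  e.g. `(x_0 + ⋯ + x_{n/2−1})·(x_{n/2} + ⋯ + x_{n−1})` — rank 2, all `n` digits, full bandwidth, not a
  junta, not digit-local — and the truncated mirror forms `Σ_{j<h} x_j x_{n−1−j}`, `h ≤ n^c`;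
* every polynomial with at most `n^c` monomials, of ANY degree (`digitPolyUniformity_sparse`: a monomial
  is a product of the affine forms `x_i`).

Mechanism (`Walsh spectral norm`, made elementary): `(−1)^{Π_{i<D} v_i} = 1 − (2/2^D)·Σ_{t ⊆ [D]} (−1)^{|t|}(−1)^{Σ_{i∈t} v_i}`
(`phase_prod_expand`), so adding one product of affine forms to `P'` costs a factor `3` on the affine
correlation bound (`corr_add_prod_eq`, `abs_corr_affine_products_le`: `|Σ λ(−1)^P| ≤ 3^h·B` whenever
every affine phase has correlation `≤ B`), and Bourgain's uniform Walsh bound `B = 2^{n−n^{c₀}}`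
(`affine_corr_le_eventually`, from the PROVED `WalshLiouvilleBound`) absorbs `3^h` for `h ≤ n^{c₀/2}`.

What stays open: phases needing `h ≫ n^{c₀}` products — bent-type quadratics of rank `≍ n` such as the
full mirror form (crux `QuadraticDigitPhases`, stmt-1391) — and, a fortiori, generic polylog-degree phases.
-/

set_option linter.dupNamespace false -- D-0017: single-problem summit ⇒ `QuantumAdvantage.QuantumAdvantage` by design

noncomputable section

namespace Summit.QuantumAdvantage.QuantumAdvantage.Theorems.MobiusLadder

open Filter Finset
open Literature.Computability.MetaComplexity (boolFunEquivFin)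
open Literature.Computability.MetaComplexity.Smolensky (CubeFn lowDeg mono)
open Literature.Probability.RandomGraphs.LowDegree (walsh)
open Summit.QuantumAdvantage.DigitPolyUniformity.SketchLAR
  (stub_eval_mem_lowDeg stub_lowDeg_one_walsh stub_walsh_cube_bound)
open Summit.QuantumAdvantage.QuantumAdvantage.Theorems.MobiusLadderQuadraticDigitPhasesStubOneCutKatai
  (sign_add sign_sum)

namespace AffineProducts

/-! ### The phase character of `𝔽₂` and the expansion of a product -/

/-! The phase `w ↦ (−1)^{[w = 1]}` is a character of `(𝔽₂, +)`: `sign_add`, `sign_sum` of the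
`QuadraticDigitPhases` line (`Theorems/MobiusLadderQuadraticDigitPhasesStubOneCutKataiCS.lean`), reused. -/

/-- In `𝔽₂` a finite product is `1` iff every factor is `1`. [folklore] -/
theorem prod_eq_one_iff {ι : Type*} (s : Finset ι) (v : ι → ZMod 2) :
    ∏ i ∈ s, v i = 1 ↔ ∀ i ∈ s, v i = 1 := by
  classical
  induction s using Finset.induction_on with
  | empty => simp
  | insert a s ha ih =>
    rw [Finset.prod_insert ha, Finset.forall_mem_insert, ← ih]
    generalize ∏ i ∈ s, v i = w
    revert w
    generalize v a = u
    revert u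
    decide

/-- `1 − (−1)^{[w=1]} = 2·[w = 1]`. [folklore] -/
theorem one_sub_phase (w : ZMod 2) :
    1 - (if w = 1 then (-1 : ℝ) else 1) = if w = 1 then (2 : ℝ) else 0 := by
  split_ifs <;> norm_num

/-- **Expansion of the phase of a product**: for `v : Fin D → 𝔽₂`,
`(−1)^{[Π_i v_i = 1]} = 1 − (2/2^D) · Σ_{t ⊆ [D]} (−1)^{|t|} · (−1)^{[Σ_{i∈t} v_i = 1]}`
(from `[Π v_i = 1] = Π_i [v_i = 1] = Π_i (1 − (−1)^{[v_i=1]})/2` and the expansion of the product).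
[folklore] -/
theorem phase_prod_expand {D : ℕ} (v : Fin D → ZMod 2) :
    (if ∏ i, v i = 1 then (-1 : ℝ) else 1) =
      1 - (2 / 2 ^ D) * ∑ t ∈ (Finset.univ : Finset (Fin D)).powerset,
        (-1 : ℝ) ^ t.card * (if ∑ i ∈ t, v i = 1 then (-1 : ℝ) else 1) := by
  -- `Π_i (1 − phase(v_i)) = Σ_t (−1)^{|t|} phase(Σ_t v)`
  have hexp : ∏ i : Fin D, (1 - (if v i = 1 then (-1 : ℝ) else 1)) =
      ∑ t ∈ (Finset.univ : Finset (Fin D)).powerset,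
        (-1 : ℝ) ^ t.card * (if ∑ i ∈ t, v i = 1 then (-1 : ℝ) else 1) := by
    have h1 : ∏ i : Fin D, (1 - (if v i = 1 then (-1 : ℝ) else 1)) =
        ∏ i : Fin D, (-(if v i = 1 then (-1 : ℝ) else 1) + 1) :=
      Finset.prod_congr rfl fun i _ => by ring
    rw [h1, Finset.prod_add]
    refine Finset.sum_congr rfl fun t _ => ?_
    rw [Finset.prod_const_one, mul_one, sign_sum, Finset.prod_neg, Finset.prod_congr rfl fun i _ => rfl]
  -- `Π_i (1 − phase(v_i)) = 2^D [∀ i, v_i = 1]`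
  have hind : ∏ i : Fin D, (1 - (if v i = 1 then (-1 : ℝ) else 1)) =
      if ∀ i, v i = 1 then (2 : ℝ) ^ D else 0 := by
    simp_rw [one_sub_phase]
    split_ifs with hall
    · rw [Finset.prod_congr rfl fun i _ => if_pos (hall i), Finset.prod_const, Finset.card_univ,
        Fintype.card_fin]
    · push Not at hall
      obtain ⟨i, hi⟩ := hall
      exact Finset.prod_eq_zero (Finset.mem_univ i) (if_neg hi)
  rw [← hexp, hind]
  have hiff : (∏ i, v i = 1) ↔ ∀ i, v i = 1 := by
    rw [prod_eq_one_iff]; simp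
  by_cases hall : ∀ i, v i = 1
  · rw [if_pos (hiff.2 hall), if_pos hall]
    have h2 : (2 : ℝ) ^ D ≠ 0 := by positivity
    field_simp
    ring
  · rw [if_neg (fun h => hall (hiff.1 h)), if_neg hall]
    ring

/-- The same with a carrier phase `u`: `(−1)^{[u + Π_i v_i = 1]} =
(−1)^{[u=1]} − (2/2^D) Σ_t (−1)^{|t|} (−1)^{[u + Σ_{i∈t} v_i = 1]}`. [folklore] -/
theorem phase_add_prod_expand {D : ℕ} (u : ZMod 2) (v : Fin D → ZMod 2) :
    (if u + ∏ i, v i = 1 then (-1 : ℝ) else 1) =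
      (if u = 1 then (-1 : ℝ) else 1) - (2 / 2 ^ D) * ∑ t ∈ (Finset.univ : Finset (Fin D)).powerset,
        (-1 : ℝ) ^ t.card * (if u + ∑ i ∈ t, v i = 1 then (-1 : ℝ) else 1) := by
  rw [sign_add, phase_prod_expand, mul_sub, mul_one, Finset.mul_sum, Finset.mul_sum, Finset.mul_sum]
  congr 1
  refine Finset.sum_congr rfl fun t _ => ?_
  rw [sign_add]
  ring

/-! ### One product of affine forms costs a factor `3` -/

/-- **One step on correlations**: for any `P` and any family `M : Fin D → 𝔽₂[x]`,
`Σ_N λ(N)(−1)^{[(P + Π_i M_i)(bits N) = 1]} = Σ_N λ(N)(−1)^{[P = 1]} − (2/2^D) Σ_{t ⊆ [D]} (−1)^{|t|} Σ_N λ(N)(−1)^{[(P + Σ_{i∈t} M_i) = 1]}`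
(pointwise `phase_add_prod_expand`, `eval` is a ring hom). [folklore] -/
theorem corr_add_prod_eq {n D : ℕ} (P : MvPolynomial (Fin n) (ZMod 2))
    (M : Fin D → MvPolynomial (Fin n) (ZMod 2)) :
    ∑ N ∈ range (2 ^ n), ((ArithmeticFunction.liouville N : ℤ) : ℝ) *
        (if MvPolynomial.eval (fun i : Fin n => if Nat.testBit N i then (1 : ZMod 2) else 0) (P + ∏ i, M i) = 1
          then (-1 : ℝ) else 1) =
      ∑ N ∈ range (2 ^ n), ((ArithmeticFunction.liouville N : ℤ) : ℝ) *
          (if MvPolynomial.eval (fun i : Fin n => if Nat.testBit N i then (1 : ZMod 2) else 0) P = 1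
            then (-1 : ℝ) else 1) -
        (2 / 2 ^ D) * ∑ t ∈ (Finset.univ : Finset (Fin D)).powerset, (-1 : ℝ) ^ t.card *
          ∑ N ∈ range (2 ^ n), ((ArithmeticFunction.liouville N : ℤ) : ℝ) *
            (if MvPolynomial.eval (fun i : Fin n => if Nat.testBit N i then (1 : ZMod 2) else 0)
                (P + ∑ i ∈ t, M i) = 1 then (-1 : ℝ) else 1) := by
  -- pointwise expansion
  have hpt : ∀ N : ℕ,
      (if MvPolynomial.eval (fun i : Fin n => if Nat.testBit N i then (1 : ZMod 2) else 0) (P + ∏ i, M i) = 1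
        then (-1 : ℝ) else 1) =
      (if MvPolynomial.eval (fun i : Fin n => if Nat.testBit N i then (1 : ZMod 2) else 0) P = 1
          then (-1 : ℝ) else 1) -
        (2 / 2 ^ D) * ∑ t ∈ (Finset.univ : Finset (Fin D)).powerset, (-1 : ℝ) ^ t.card *
          (if MvPolynomial.eval (fun i : Fin n => if Nat.testBit N i then (1 : ZMod 2) else 0)
              (P + ∑ i ∈ t, M i) = 1 then (-1 : ℝ) else 1) := by
    intro N
    rw [map_add, map_prod, phase_add_prod_expand]
    congr 1
    congr 1
    refine Finset.sum_congr rfl fun t _ => ?_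
    rw [map_add, map_sum]
  rw [Finset.sum_congr rfl fun N _ => by rw [hpt N]]
  simp_rw [mul_sub]
  rw [Finset.sum_sub_distrib]
  congr 1
  simp_rw [Finset.mul_sum]
  rw [Finset.sum_comm]
  refine Finset.sum_congr rfl fun t _ => Finset.sum_congr rfl fun N _ => ?_
  ring

/-- **The class `A + Σ_{j<h} Π_i L_{j,i}`, all `A, L_{j,i}` affine, costs `3^h`**: if every affine phase
has correlation `≤ B` with `λ` on `[0, 2ⁿ)`, then every such `P` has correlation `≤ 3^h·B`. Induction on
`h`, peeling the last product with `corr_add_prod_eq` (the `2^D` shifted polynomials `P' + Σ_{i∈t} L_{h,i}`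
are again in the class with `h − 1` products, the shift being affine). [folklore] -/
theorem abs_corr_affine_products_le (h : ℕ) : ∀ {n : ℕ} (B : ℝ),
    (∀ A : MvPolynomial (Fin n) (ZMod 2), A.totalDegree ≤ 1 →
      |∑ N ∈ range (2 ^ n), ((ArithmeticFunction.liouville N : ℤ) : ℝ) *
          (if MvPolynomial.eval (fun i : Fin n => if Nat.testBit N i then (1 : ZMod 2) else 0) A = 1
            then (-1 : ℝ) else 1)| ≤ B) →
    ∀ (D : ℕ) (A : MvPolynomial (Fin n) (ZMod 2)) (L : Fin h → Fin D → MvPolynomial (Fin n) (ZMod 2)),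
      A.totalDegree ≤ 1 → (∀ j i, (L j i).totalDegree ≤ 1) →
      |∑ N ∈ range (2 ^ n), ((ArithmeticFunction.liouville N : ℤ) : ℝ) *
          (if MvPolynomial.eval (fun i : Fin n => if Nat.testBit N i then (1 : ZMod 2) else 0)
              (A + ∑ j, ∏ i, L j i) = 1 then (-1 : ℝ) else 1)| ≤ 3 ^ h * B := by
  induction h with
  | zero =>
    intro n B hB D A L hA hL
    simp only [Finset.univ_eq_empty, Finset.sum_empty, add_zero, pow_zero, one_mul]
    exact hB A hA
  | succ h ih =>
    intro n B hB D A L hA hL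
    have hsplit : A + ∑ j : Fin (h + 1), ∏ i, L j i =
        (A + ∑ j : Fin h, ∏ i, L (Fin.castSucc j) i) + ∏ i, L (Fin.last h) i := by
      rw [Fin.sum_univ_castSucc, add_assoc]
    rw [hsplit, corr_add_prod_eq]
    set P' : MvPolynomial (Fin n) (ZMod 2) := A + ∑ j : Fin h, ∏ i, L (Fin.castSucc j) i with hP'
    have h0 : |∑ N ∈ range (2 ^ n), ((ArithmeticFunction.liouville N : ℤ) : ℝ) *
        (if MvPolynomial.eval (fun i : Fin n => if Nat.testBit N i then (1 : ZMod 2) else 0) P' = 1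
          then (-1 : ℝ) else 1)| ≤ 3 ^ h * B :=
      ih B hB D A (fun j => L (Fin.castSucc j)) hA (fun j i => hL _ _)
    have ht : ∀ t : Finset (Fin D),
        |∑ N ∈ range (2 ^ n), ((ArithmeticFunction.liouville N : ℤ) : ℝ) *
          (if MvPolynomial.eval (fun i : Fin n => if Nat.testBit N i then (1 : ZMod 2) else 0)
              (P' + ∑ i ∈ t, L (Fin.last h) i) = 1 then (-1 : ℝ) else 1)| ≤ 3 ^ h * B := by
      intro t
      have hre : P' + ∑ i ∈ t, L (Fin.last h) i =
          (A + ∑ i ∈ t, L (Fin.last h) i) + ∑ j : Fin h, ∏ i, L (Fin.castSucc j) i :=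
        add_right_comm _ _ _
      rw [hre]
      refine ih B hB D _ (fun j => L (Fin.castSucc j)) ?_ (fun j i => hL _ _)
      refine (MvPolynomial.totalDegree_add _ _).trans (max_le hA ?_)
      exact MvPolynomial.totalDegree_finsetSum_le fun i _ => hL _ _
    -- the `2^D` shifted terms
    have hsum : |∑ t ∈ (Finset.univ : Finset (Fin D)).powerset, (-1 : ℝ) ^ t.card *
        ∑ N ∈ range (2 ^ n), ((ArithmeticFunction.liouville N : ℤ) : ℝ) *
          (if MvPolynomial.eval (fun i : Fin n => if Nat.testBit N i then (1 : ZMod 2) else 0)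
              (P' + ∑ i ∈ t, L (Fin.last h) i) = 1 then (-1 : ℝ) else 1)| ≤ 2 ^ D * (3 ^ h * B) := by
      refine (Finset.abs_sum_le_sum_abs _ _).trans ?_
      have hcard : ((Finset.univ : Finset (Fin D)).powerset).card = 2 ^ D := by
        rw [Finset.card_powerset, Finset.card_univ, Fintype.card_fin]
      calc ∑ t ∈ (Finset.univ : Finset (Fin D)).powerset, |(-1 : ℝ) ^ t.card *
            ∑ N ∈ range (2 ^ n), ((ArithmeticFunction.liouville N : ℤ) : ℝ) *
              (if MvPolynomial.eval (fun i : Fin n => if Nat.testBit N i then (1 : ZMod 2) else 0)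
                  (P' + ∑ i ∈ t, L (Fin.last h) i) = 1 then (-1 : ℝ) else 1)|
          ≤ ∑ t ∈ (Finset.univ : Finset (Fin D)).powerset, 3 ^ h * B := by
            refine Finset.sum_le_sum fun t _ => ?_
            rw [abs_mul, abs_pow, abs_neg, abs_one, one_pow, one_mul]
            exact ht t
        _ = 2 ^ D * (3 ^ h * B) := by rw [Finset.sum_const, hcard, nsmul_eq_mul]; push_cast; ring
    have h2D : (0 : ℝ) < 2 / 2 ^ D := by positivity
    calc _ ≤ |∑ N ∈ range (2 ^ n), ((ArithmeticFunction.liouville N : ℤ) : ℝ) *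
          (if MvPolynomial.eval (fun i : Fin n => if Nat.testBit N i then (1 : ZMod 2) else 0) P' = 1
            then (-1 : ℝ) else 1)| +
          |(2 / 2 ^ D) * ∑ t ∈ (Finset.univ : Finset (Fin D)).powerset, (-1 : ℝ) ^ t.card *
            ∑ N ∈ range (2 ^ n), ((ArithmeticFunction.liouville N : ℤ) : ℝ) *
              (if MvPolynomial.eval (fun i : Fin n => if Nat.testBit N i then (1 : ZMod 2) else 0)
                  (P' + ∑ i ∈ t, L (Fin.last h) i) = 1 then (-1 : ℝ) else 1)| := abs_sub _ _
      _ ≤ 3 ^ h * B + (2 / 2 ^ D) * (2 ^ D * (3 ^ h * B)) := by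
          rw [abs_mul, abs_of_pos h2D]
          exact add_le_add h0 (mul_le_mul_of_nonneg_left hsum h2D.le)
      _ = 3 ^ (h + 1) * B := by
          have h2 : (2 : ℝ) ^ D ≠ 0 := by positivity
          field_simp
          ring

/-! ### The affine bound (Bourgain) and the main theorem -/

/-- **Bourgain's bound for affine phases, crux form**: there is `c > 0` such that eventually in `n` every
`A ∈ 𝔽₂[x_0..x_{n−1}]` of total degree `≤ 1` has `|Σ_{N<2ⁿ} λ(N)(−1)^{A(bits N)}| ≤ 2^{n−n^c}` (the phase
is `±` a Walsh character, `stub_lowDeg_one_walsh`; `stub_walsh_cube_bound` is the PROVED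
`WalshLiouvilleBound` in cube form). [folklore] -/
theorem affine_corr_le_eventually : ∃ c : ℝ, 0 < c ∧ ∀ᶠ n : ℕ in atTop,
    ∀ A : MvPolynomial (Fin n) (ZMod 2), A.totalDegree ≤ 1 →
      |∑ N ∈ range (2 ^ n), ((ArithmeticFunction.liouville N : ℤ) : ℝ) *
          (if MvPolynomial.eval (fun i : Fin n => if Nat.testBit N i then (1 : ZMod 2) else 0) A = 1
            then (-1 : ℝ) else 1)| ≤ (2 : ℝ) ^ ((n : ℝ) - (n : ℝ) ^ c) := by
  obtain ⟨c, hc, hwalsh⟩ := stub_walsh_cube_bound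
  refine ⟨c, hc, hwalsh.mono fun n hwn A hA => ?_⟩
  set g : CubeFn (ZMod 2) n := fun b =>
    MvPolynomial.eval (fun i : Fin n => if b i then (1 : ZMod 2) else 0) A with hg_def
  have hg : g ∈ lowDeg (ZMod 2) n 1 := stub_eval_mem_lowDeg A hA
  obtain ⟨S, c', hc', hphase⟩ := stub_lowDeg_one_walsh g hg
  rw [sum_range_phase_eq_sum_cube_eval]
  have hrw : ∑ b : Fin n → Bool,
      ((ArithmeticFunction.liouville ((boolFunEquivFin n b : Fin (2 ^ n)) : ℕ) : ℤ) : ℝ) *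
        (if MvPolynomial.eval (fun i : Fin n => if b i then (1 : ZMod 2) else 0) A = 1
          then (-1 : ℝ) else 1) =
      c' * ∑ b : Fin n → Bool,
        ((ArithmeticFunction.liouville ((boolFunEquivFin n b : Fin (2 ^ n)) : ℕ) : ℤ) : ℝ) * walsh S b := by
    rw [Finset.mul_sum]
    refine Finset.sum_congr rfl fun b _ => ?_
    have hb := hphase b
    simp only [hg_def] at hb
    rw [hb]
    ring
  rw [hrw, abs_mul]
  have habs1 : |c'| = 1 := by
    rcases hc' with rfl | rfl <;> simp
  rw [habs1, one_mul]
  exact hwn S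

end AffineProducts

/-- **`λ` is orthogonal to every sum of `≤ n^c` products of affine forms** (unconditional sub-class of the
crux `DigitPolyUniformity`, of ANY degree and on ANY set of digits): there is `c > 0` such that for every
`ε > 0`, eventually in `n`, for all `h ≤ n^c`, all `D`, every affine `A` and all affine `L_{j,i}`
(`j < h`, `i < D`), the polynomial `P = A + Σ_{j<h} Π_{i<D} L_{j,i} ∈ 𝔽₂[x_0..x_{n−1}]` satisfies
`|Σ_{N<2ⁿ} λ(N)(−1)^{P(bits N)}| ≤ ε·2ⁿ`. Contains all quadratics of symplectic rank `≤ 2n^c` (Dickson)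
and all `n^c`-sparse polynomials. Proof: `3^h · 2^{n − n^{c₀}} ≤ 2^{n − n^{c₀}/2}` for `h ≤ n^{c₀/2}`,
`n^{c₀/2} ≥ 4`. [folklore] -/
theorem digitPolyUniformity_affine_products : ∃ c : ℝ, 0 < c ∧ ∀ ε : ℝ, 0 < ε → ∀ᶠ n : ℕ in atTop,
    ∀ (h D : ℕ) (A : MvPolynomial (Fin n) (ZMod 2)) (L : Fin h → Fin D → MvPolynomial (Fin n) (ZMod 2)),
      (h : ℝ) ≤ (n : ℝ) ^ c → A.totalDegree ≤ 1 → (∀ j i, (L j i).totalDegree ≤ 1) →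
      |∑ N ∈ range (2 ^ n), ((ArithmeticFunction.liouville N : ℤ) : ℝ) *
          (if MvPolynomial.eval (fun i : Fin n => if Nat.testBit N i then (1 : ZMod 2) else 0)
              (A + ∑ j, ∏ i, L j i) = 1 then (-1 : ℝ) else 1)| ≤ ε * (2 : ℝ) ^ n := by
  obtain ⟨c₀, hc₀, hB⟩ := AffineProducts.affine_corr_le_eventually
  refine ⟨c₀ / 2, by positivity, fun ε hε => ?_⟩
  have hpow : Tendsto (fun n : ℕ => ((n : ℝ) ^ (c₀ / 2))) atTop atTop :=
    (tendsto_rpow_atTop (by positivity)).comp tendsto_natCast_atTop_atTop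
  have hev1 : ∀ᶠ n : ℕ in atTop, (4 : ℝ) ≤ (n : ℝ) ^ (c₀ / 2) := hpow.eventually_ge_atTop _
  have hev2 : ∀ᶠ n : ℕ in atTop, 2 * Real.logb 2 (1 / ε) ≤ (n : ℝ) ^ (c₀ / 2) := hpow.eventually_ge_atTop _
  have hev3 : ∀ᶠ n : ℕ in atTop, 1 ≤ n := eventually_ge_atTop 1
  filter_upwards [hB, hev1, hev2, hev3] with n hBn h1 h2 h3
  intro h D A L hh hA hL
  have hnpos : (0 : ℝ) < n := by exact_mod_cast (show 0 < n by omega)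
  -- `n^{c₀/2} · n^{c₀/2} = n^{c₀}`
  have hsq : (n : ℝ) ^ (c₀ / 2) * (n : ℝ) ^ (c₀ / 2) = (n : ℝ) ^ c₀ := by
    rw [← Real.rpow_add hnpos]; ring_nf
  have hmain := AffineProducts.abs_corr_affine_products_le h ((2 : ℝ) ^ ((n : ℝ) - (n : ℝ) ^ c₀)) hBn D A L hA hL
  refine hmain.trans ?_
  -- `3^h ≤ 4^h = 2^{2h} ≤ 2^{n^{c₀}/2}`
  have h3 : (3 : ℝ) ^ h ≤ (2 : ℝ) ^ ((n : ℝ) ^ c₀ / 2) := by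
    calc (3 : ℝ) ^ h ≤ (4 : ℝ) ^ h := pow_le_pow_left₀ (by norm_num) (by norm_num) h
      _ = (2 : ℝ) ^ ((2 * h : ℕ) : ℝ) := by
          rw [Real.rpow_natCast, pow_mul]; norm_num
      _ ≤ (2 : ℝ) ^ ((n : ℝ) ^ c₀ / 2) := by
          refine Real.rpow_le_rpow_of_exponent_le one_le_two ?_
          push_cast
          -- `2h ≤ 2 n^{c₀/2} ≤ n^{c₀/2} · n^{c₀/2} / 2`
          nlinarith [hh, h1, hsq, Real.rpow_nonneg hnpos.le (c₀ / 2)]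
  -- `2^{-n^{c₀}/2} ≤ ε`
  have heps : (2 : ℝ) ^ (-((n : ℝ) ^ c₀ / 2)) ≤ ε := by
    have hle : Real.logb 2 (1 / ε) ≤ (n : ℝ) ^ c₀ / 2 := by
      nlinarith [h2, h1, hsq, Real.rpow_nonneg hnpos.le (c₀ / 2)]
    have := Real.rpow_le_rpow_of_exponent_le one_le_two (neg_le_neg hle)
    refine this.trans ?_
    rw [Real.rpow_neg zero_le_two, Real.rpow_logb two_pos (by norm_num) (by positivity), one_div, inv_inv]
  have h2n : (0 : ℝ) < (2 : ℝ) ^ ((n : ℝ) - (n : ℝ) ^ c₀) := by positivity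
  calc (3 : ℝ) ^ h * (2 : ℝ) ^ ((n : ℝ) - (n : ℝ) ^ c₀)
      ≤ (2 : ℝ) ^ ((n : ℝ) ^ c₀ / 2) * (2 : ℝ) ^ ((n : ℝ) - (n : ℝ) ^ c₀) :=
        mul_le_mul_of_nonneg_right h3 h2n.le
    _ = (2 : ℝ) ^ (n : ℝ) * (2 : ℝ) ^ (-((n : ℝ) ^ c₀ / 2)) := by
        rw [← Real.rpow_add two_pos, ← Real.rpow_add two_pos]; ring_nf
    _ ≤ (2 : ℝ) ^ (n : ℝ) * ε := mul_le_mul_of_nonneg_left heps (by positivity)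
    _ = ε * 2 ^ n := by rw [Real.rpow_natCast]; ring

end Summit.QuantumAdvantage.QuantumAdvantage.Theorems.MobiusLadder

end
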